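import Summits.HodgeConjecture.HodgeConjecture.Theses.HeckePrymWeil

/-!
# `WeilTenfoldsSqrtMinus11` (stmt-HodgeConjecture-1262) · Negative · typing of the cyclotomic anchor stubs

Negative-side support file of the standing crux disprover (cdisprove seat
`refuter-cdisprove-stmt-HodgeConjecture-1262-g2-0`, cycle 2, 2026-08-16), extracted from the work file
`Cruxes/WeilTenfoldsSqrtMinus11/Disproof.lean` §H. Everything is unconditional and `sorry`-free.

Context. Four of the six crux ideas filed on this crux (`quaternionic-norm-anchors`,
`odd-norm-cm-enlargement`, `balanced-undecic-pencil`, `quaternionic-orbit-compactness`) anchor the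
`ℚ(√-11)`-Weil tenfold problem at abelian tenfolds carrying an endomorphism `ψ` of order `11`
(`L = ℚ(ζ₁₁) ⊃ K = ℚ(√-11)`), with the crux's `φ` recovered as the quadratic Gauss sum `g(ψ)`, and
type their "signature `(1,1)` at every place of `L`" hypothesis through the eigenspaces of
`(𝟙 + ψ)^*` on `H²(A(ℂ); ℂ)` for the eigenvalues `(1 + u)²`, `u ∈ μ₁₁ ∖ {1}`
(`SketchIdeatorOne.SignatureOneOne`, `IdeatorTwo.cycloDivisorLine`). The disprover tried to make these
stubs VACUOUS or JUNK-SATISFIABLE through eigenvalue collisions on `∧²H¹ = ⊕ U_v ⊗ U_w`; the arithmetic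
deciding the attempt is kernel-checked here (the attempt fails — the typing is exact):

* `rootOfUnity_one_add_mul_collision_free` : for `n` ODD and `u, v, w ∈ μ_n(ℂ)` (the value `1`
  allowed), `(1+v)(1+w) = (1+u)²` forces `v = w = u`. So the `(1+u)²`-eigenspace of `(𝟙+ψ)^*` on
  `∧²H¹` is exactly `∧²U_u` — no mixed summand `U_v ⊗ U_w` and no summand involving the `ψ^* = 1`
  block rides along (`one_add_sq_ne_four`, `two_mul_one_add_ne_one_add_sq`); proof: complex
  conjugation inverts roots of unity, the conjugate equation gives `vw = u²`, then `v + w = 2u`.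
  `collision_at_even` records that oddness is needed (`n = 2`: `u = v = -1`, `w = 1`).
* `gaussSum11_sq` : in ANY ring, `z¹¹ = 1 → g(z)² = -11 + Σ_{k<11} zᵏ` (`gaussSum11_poly_identity`:
  `g(X)² + 11 - Σ Xᵏ = (X¹¹ - 1)·q(X)` in `ℤ[X]`, pushed through `Polynomial.aeval`). Hence, given
  `ψ¹¹ = 𝟙`, the crux hypothesis `φ ≫ φ = -11` for `φ = g(ψ)` is EQUIVALENT to the vanishing of the
  norm `Σ_{k<11} ψᵏ = 0` (`gaussSum11_sq_eq_neg_eleven_iff`): card `quaternionic-norm-anchors`'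
  `(pow11 ψ = 𝟙, φ = gaussSum ψ, φ ≫ φ = -11)` and cards `odd-norm-cm-enlargement` /
  `balanced-undecic-pencil`'s `(ζ¹¹ = 1, Σ ζᵏ = 0)` type the same anchors. Adversarial remark recorded
  in the work file: `SignatureOneOne` alone does NOT exclude the eigenvalue `1` of `ψ^*` on `H¹` (it
  bounds eigenspaces from above, and they may vanish: `A = B⁵ × (CM fivefold by ℚ(ζ₁₁))`,
  `ψ = 𝟙 × ζ`); there `g(ψ) = 0 × √-11`, so it is `φ ≫ φ = -11` (equivalently `Σ ψᵏ = 0`) that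
  removes this junk model from `CyclotomicNormAnchor`, not the signature hypothesis.
-/

noncomputable section

namespace Summit.HodgeConjecture.HodgeConjecture.Theorems.WeilTenfoldsSqrtMinus11.Negative

open Complex

/-! ## Roots of unity in `ℂ`: conjugate = inverse (Mathlib: `Complex.norm_eq_one_of_pow_eq_one`,
`Complex.inv_eq_conj`) -/

/-- For a complex root of unity, `conj x = x⁻¹`. [folklore] -/
theorem conj_eq_inv_of_pow_eq_one {x : ℂ} {n : ℕ} (hn : n ≠ 0) (hx : x ^ n = 1) :
    starRingEnd ℂ x = x⁻¹ :=
  (Complex.inv_eq_conj (Complex.norm_eq_one_of_pow_eq_one hx hn)).symm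

/-- For `n` odd, `-1` is not an `n`-th root of unity: `x ^ n = 1 → 1 + x ≠ 0`. [folklore] -/
theorem one_add_ne_zero_of_pow_eq_one_odd {x : ℂ} {n : ℕ} (hn : Odd n) (hx : x ^ n = 1) :
    1 + x ≠ 0 := by
  intro h
  have hx' : x = -1 := by linear_combination h
  rw [hx', hn.neg_one_pow] at hx
  norm_num at hx

/-! ## No collisions among the `(1+u)(1+v)`, `u, v ∈ μ_n`, `n` odd -/

/-- Pure algebra: `v + w = 2u` and `v w = u²` force `v = w = u` (the roots of `(X - u)²`). [folklore] -/
theorem eq_of_add_eq_two_mul_of_mul_eq_sq {v w u : ℂ} (hs : v + w = 2 * u) (hp : v * w = u ^ 2) :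
    v = u ∧ w = u := by
  have hv : (v - u) ^ 2 = 0 := by linear_combination v * hs - hp
  have hv' : v = u := by
    have := pow_eq_zero_iff (n := 2) (by norm_num) |>.1 hv
    linear_combination this
  refine ⟨hv', ?_⟩
  rw [hv'] at hs
  linear_combination hs

/-- **Collision-freeness of the anchor typing on `∧²H¹`.** For `n` odd and `n`-th roots of unity
`u, v, w ∈ ℂ` (the value `1` allowed): `(1 + v)(1 + w) = (1 + u)²` forces `v = w = u`.  Proof:
complex conjugation inverts roots of unity, so the conjugate equation reads
`(1+v)(1+w)/(vw) = (1+u)²/u²`, whence `vw = u²` (`1 + u ≠ 0` as `n` is odd); expanding then gives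
`v + w = 2u`, and `v, w` are the double root `u` of `(X-u)²`.  For EVEN `n` it fails
(`u = v = -1`, `w = 1`). [folklore] -/
theorem rootOfUnity_one_add_mul_collision_free {n : ℕ} (hn : Odd n) {u v w : ℂ}
    (hu : u ^ n = 1) (hv : v ^ n = 1) (hw : w ^ n = 1)
    (h : (1 + v) * (1 + w) = (1 + u) ^ 2) : v = u ∧ w = u := by
  have hn0 : n ≠ 0 := by rintro rfl; exact (Nat.not_odd_zero hn).elim
  have hu0 : u ≠ 0 := ne_zero_pow hn0 (hu ▸ one_ne_zero)
  have hv0 : v ≠ 0 := ne_zero_pow hn0 (hv ▸ one_ne_zero)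
  have hw0 : w ≠ 0 := ne_zero_pow hn0 (hw ▸ one_ne_zero)
  -- conjugate equation
  have hc : (1 + v⁻¹) * (1 + w⁻¹) = (1 + u⁻¹) ^ 2 := by
    have := congrArg (starRingEnd ℂ) h
    simpa [map_mul, map_add, map_pow, conj_eq_inv_of_pow_eq_one hn0 hu,
      conj_eq_inv_of_pow_eq_one hn0 hv, conj_eq_inv_of_pow_eq_one hn0 hw] using this
  -- clear denominators: `(1+v)(1+w) u² = (1+u)² v w`
  have hc' : (1 + v) * (1 + w) * u ^ 2 = (1 + u) ^ 2 * (v * w) := by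
    field_simp at hc
    linear_combination hc
  have hP : (1 + u) ^ 2 ≠ 0 := pow_ne_zero _ (one_add_ne_zero_of_pow_eq_one_odd hn hu)
  have hprod : v * w = u ^ 2 := by
    rw [h] at hc'
    exact (mul_left_cancel₀ hP hc').symm
  have hsum : v + w = 2 * u := by
    have : (1 + v) * (1 + w) = 1 + (v + w) + v * w := by ring
    rw [this, hprod] at h
    linear_combination h
  exact eq_of_add_eq_two_mul_of_mul_eq_sq hsum hprod

/-- The even case really collides: `n = 2`, `u = v = -1`, `w = 1`. [folklore] -/
theorem collision_at_even : ((1 : ℂ) + (-1)) * (1 + 1) = (1 + (-1)) ^ 2 ∧ ((-1 : ℂ)) ^ 2 = 1 ∧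
    ((1 : ℂ)) ^ 2 = 1 ∧ (1 : ℂ) ≠ -1 := by
  refine ⟨by norm_num, by norm_num, by norm_num, by norm_num⟩

/-- **No eigenvalue-`1` interference, I.** For `n` odd and `u ∈ μ_n`, `u ≠ 1`: `(1+u)² ≠ 4`
(`= (1+1)²`, the eigenvalue of `(𝟙+ψ)^*` on `∧²` of the `ψ^* = 1` block). [folklore] -/
theorem one_add_sq_ne_four {n : ℕ} (hn : Odd n) {u : ℂ} (hu : u ^ n = 1) (hu1 : u ≠ 1) :
    (1 + u) ^ 2 ≠ 4 := by
  intro h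
  have h' : (1 + u) * (1 + u) = (1 + (1 : ℂ)) ^ 2 := by rw [← sq, h]; norm_num
  exact hu1 (rootOfUnity_one_add_mul_collision_free hn (one_pow n) hu hu h').1

/-- **No eigenvalue-`1` interference, II.** For `n` odd and `u, v ∈ μ_n`, `u ≠ 1`:
`2(1+v) ≠ (1+u)²` (`2(1+v) = (1+1)(1+v)`, the eigenvalue on the block `H¹_{ψ^*=1} ⊗ U_v`).
[folklore] -/
theorem two_mul_one_add_ne_one_add_sq {n : ℕ} (hn : Odd n) {u v : ℂ} (hu : u ^ n = 1)
    (hv : v ^ n = 1) (hu1 : u ≠ 1) : 2 * (1 + v) ≠ (1 + u) ^ 2 := by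
  intro h
  have h' : (1 + (1 : ℂ)) * (1 + v) = (1 + u) ^ 2 := by rw [← h]; norm_num
  exact hu1 (rootOfUnity_one_add_mul_collision_free hn hu (one_pow n) hv h').1.symm

/-! ## The quadratic Gauss sum in an element of order `11` of any ring -/

section GaussSum

variable {R : Type*} [Ring R]

/-- `𝔤 z = g(z) = Σ_{k=1}^{10} (k|11) zᵏ` (squares mod 11: `1,3,4,5,9`), the quadratic Gauss sum in `z`,
spelled as in the crux-idea sketches (`IdeatorTwo.gaussSum`; card 1's `gaussSum` up to reassociation).
A local notation, not a definition. -/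
local notation "𝔤 " z:max => (z + z ^ 3 + z ^ 4 + z ^ 5 + z ^ 9 - z ^ 2 - z ^ 6 - z ^ 7 - z ^ 8 - z ^ 10)

open Polynomial in
/-- The polynomial identity behind `g² = -11`: in `ℤ[X]`,
`g(X)² + 11 - (1 + X + ⋯ + X¹⁰) = (X¹¹ - 1)·q(X)` for an explicit `q`. [folklore] -/
theorem gaussSum11_poly_identity :
    (𝔤 (X : ℤ[X])) ^ 2 + 11 - (Finset.range 11).sum (fun k => (X : ℤ[X]) ^ k) =
      (X ^ 11 - 1) * (X ^ 9 - 2 * X ^ 8 + 3 * X ^ 7 + X ^ 5 - 2 * X ^ 4 + 3 * X ^ 3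
        + X - 10) := by
  simp only [Finset.sum_range_succ, Finset.sum_range_zero]
  ring

/-- **`g(z)² = -11 + Σ_{k<11} zᵏ` whenever `z¹¹ = 1`**, in ANY ring (everything lives in the
commutative subring `ℤ[z]`). [folklore] -/
theorem gaussSum11_sq (z : R) (h11 : z ^ 11 = 1) :
    (𝔤 z) * (𝔤 z) = -11 + (Finset.range 11).sum (fun k => z ^ k) := by
  have key := congrArg (Polynomial.aeval (R := ℤ) z) gaussSum11_poly_identity
  simp only [map_sub, map_add, map_mul, map_pow, map_sum, Polynomial.aeval_X, map_ofNat,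
    map_one, h11, sub_self, zero_mul] at key
  rw [← sq]
  have h2 : (𝔤 z) ^ 2 + 11 = (Finset.range 11).sum (fun k => z ^ k) := sub_eq_zero.1 key
  rw [← h2]
  abel

/-- Given `z¹¹ = 1`: `g(z)² = -11 ↔ Σ_{k<11} zᵏ = 0` — the crux's endomorphism hypothesis for
`φ = g(ψ)` is exactly the vanishing of the `μ₁₁`-norm. [folklore] -/
theorem gaussSum11_sq_eq_neg_eleven_iff (z : R) (h11 : z ^ 11 = 1) :
    (𝔤 z) * (𝔤 z) = -11 ↔ (Finset.range 11).sum (fun k => z ^ k) = 0 := by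
  rw [gaussSum11_sq z h11]
  constructor
  · intro h
    have := congrArg (fun x => 11 + x) h
    simpa using this
  · intro h
    rw [h, add_zero]

/-- In the junk model where `ψ^*` has the eigenvalue `1` (scalar shadow: `z = 1`), the norm is `11 ≠ 0`
and `g(1) = 0`, so `g(1)² = 0 ≠ -11`: the block `ψ = 𝟙` violates `φ ≫ φ = -11`. [folklore] -/
theorem gaussSum11_one : (𝔤 (1 : ℤ)) = 0 ∧ (Finset.range 11).sum (fun k => (1 : ℤ) ^ k) = 11 := by
  refine ⟨by norm_num, by simp⟩

end GaussSum

end Summit.HodgeConjecture.HodgeConjecture.Theorems.WeilTenfoldsSqrtMinus11.Negative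

end
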